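import Literature.MathematicalPhysics.QuantumFieldTheory.OSTemperedBound
import HarnessLib

/-!
# The temperedness estimate (4.6) with explicit constants

Topic `Literature/MathematicalPhysics/QuantumFieldTheory`; support file (all proved; the explicit
constants as definitions; no named facts) for the discharge of (A1) `OS1975_exists_timeContinuation`,
a variant of `OSTemperedBound.IsOSLabelledRealData.exists_tempered_tower` (OS II Ch. VI.2) which
keeps track of the dependence of the final constant on the real-point constants `α_k`:
`‖Sext k c ζ‖ ≤ α_k · Q_k · (1 + ∑‖ζᵢ‖)^{e_k} (1 + ∑ (Re ζᵢ)⁻¹)^{e_k}` with `Q_k = temperedQ CT γ t k` and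
`e_k = temperedE CT γ t k` depending only on the semigroup bound `CT`, the geometric ratio `γ` and the
exponent `t` of the real bounds. When the labels run over balls of radius `R` and `α_k(R)` grows
polynomially in `R`, this gives the polynomial dependence of (4.6) on the spatial variables
("`(1 + max|ξ⃗ᵢ|)^{kt'}`" in (4.6)).

* `levA`, `dgOf`, `temperedE`, `temperedQ` — the constants;
* `IsOSLabelledRealData.exists_tempered_tower_explicit` — the statement.

## References

* K. Osterwalder, R. Schrader, *Axioms for Euclidean Green's functions II*, Comm. Math. Phys.
  42 (1975) 281–305, §IV.2 Thm. 4.2 (4.6); Ch. VI.2 (6.28)–(6.31). [OsterwalderSchraderCMP1975]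
-/

noncomputable section

open Metric Set Filter Complex
open scoped Topology ComplexConjugate InnerProductSpace BigOperators

namespace Literature.MathematicalPhysics.QuantumFieldTheory.OSEnvelope

open Literature.Analysis.Complex Literature.MathematicalPhysics.QuantumFieldTheory
  Literature.MathematicalPhysics.QuantumFieldTheory.LogSlot

/-! ### The explicit constants -/

/-- The level constant of `osBaseC_exists_level_arg` (a choice), dimension `k' + 1`. [folklore] -/
def levA (k' : ℕ) : ℝ := Classical.choose (osBaseC_exists_level_arg k')

/-- Its defining property. [folklore] -/
theorem levA_spec (k' : ℕ) : 1 ≤ levA k' ∧ ∀ Z : Fin (k' + 1) → ℂ, (∀ i, 0 < (Z i).re) →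
    ∃ N : ℕ, (fun i => (Z i).arg) ∈ osBaseC (N + 1) (k' + 1) ∧ (2 : ℝ) ^ N ≤ levA k' * (∑ i, ‖Z i‖ / (Z i).re) ^ 2 :=
  Classical.choose_spec (osBaseC_exists_level_arg k')

/-- A dyadic exponent for the growth factor `g`: `g < 2^{dgOf}`. [folklore] -/
def dgOf (CT γ : ℝ) (t : ℕ) : ℕ := Classical.choose (pow_unbounded_of_one_lt (gConst CT γ t) (one_lt_two (α := ℝ)))

/-- Its defining property. [folklore] -/
theorem dgOf_spec (CT γ : ℝ) (t : ℕ) : gConst CT γ t < (2 : ℝ) ^ dgOf CT γ t :=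
  Classical.choose_spec (pow_unbounded_of_one_lt (gConst CT γ t) (one_lt_two (α := ℝ)))

/-- **The exponent of (4.6)**: `e_k = 2 dg k + 2 k t`. [cite: OsterwalderSchraderCMP1975, §IV.2 (4.6)] -/
def temperedE (CT γ : ℝ) (t k : ℕ) : ℕ := 2 * dgOf CT γ t * k + 2 * k * t

/-- **The constant of (4.6) per unit real-point constant**:
`Q_k = (max 1 CT) k γᵏ (10k)^{tk} (6k)^{tk} (4 A_{k-1})^{dg k} (2(k+1))^{kt}`. [cite: OsterwalderSchraderCMP1975, §IV.2 (4.6)] -/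
def temperedQ (CT γ : ℝ) (t k : ℕ) : ℝ :=
  max 1 CT * k * γ ^ k * ((10 * k : ℝ) ^ (t * k) * (6 * k : ℝ) ^ (t * k) * (4 * levA (k - 1)) ^ (dgOf CT γ t * k) *
    (2 * (k + 1) : ℝ) ^ (k * t))

/-! ### The theorem -/

section Undo

variable {E : Type*} {H : Type*} [NormedAddCommGroup H] [InnerProductSpace ℂ H]
  [CompleteSpace H] {T : ℂ → H →L[ℂ] H} {CT : ℝ}
  {Φ : (n : ℕ) → (Fin (n + 1) → E) → ℝ → (Fin n → ℝ) → H}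
  {good : (k : ℕ) → (Fin (k + 1) → E) → Prop} {S₀ : (k : ℕ) → (Fin (k + 1) → E) → (Fin k → ℂ) → ℂ}
  {C₀ : ℕ → ℝ} {p₀ : ℕ → ℕ} {α : ℕ → ℝ} {t : ℕ} {γ : ℝ}

set_option maxHeartbeats 800000 in
/-- **Osterwalder–Schrader II, Theorem 4.2 with the temperedness estimate (4.6), from real-point
data — with the explicit dependence of the constant on the real-point constants `α`** (the bound is
`α k · temperedQ CT γ t k · (1 + ∑‖ζᵢ‖)^{e_k} (1 + ∑ (Re ζᵢ)⁻¹)^{e_k}` with `temperedQ`, `e_k = temperedE`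
independent of the data; this is what makes the bound polynomial in the size of the labels when
`α` is). Under the semigroup hypotheses, the labelled real-point vectors, a class of labels closed
under the doubling of the parts, labelled real-point data (Gram identities (5.2) at positive real
points, continuity, growth) and the **sum-form real bound with exponent linear in `k`** (E0', (6.20))
with constants `α_k` satisfying `√(α_{2p+1} α_{2q+1}) ≤ γ^k α_k`: there is a family `Sext k c`,
holomorphic on `ℂ₊ᵏ` for the good labels `c` and `k ≥ 1`, equal to `S₀ k c` at the positive real
points, and such that for every `k ≥ 1` there are `C, e` with
`‖Sext k c ζ‖ ≤ C (1 + ∑‖ζᵢ‖)^e (1 + ∑ (Re ζᵢ)⁻¹)^e` for all `ζ ∈ ℂ₊ᵏ` and all good labels `c`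
((4.6), uniformly in the labels; level choice (6.30) by `osBaseC_exists_level_arg`, shift
`ε = min 1 (1/(2∑(Re ζᵢ)⁻¹))`). [cite: OsterwalderSchraderCMP1975, §IV.2 Thm. 4.2 (4.6); Ch. VI.2 (6.28)–(6.31)] -/
theorem IsOSLabelledRealData.exists_tempered_tower_explicit (hT : IsOSSemigroup T CT) (hΦ : IsOSLabelledVectors T Φ)
    (hgood : IsOSLabelSet good) (hD : IsOSLabelledRealData good S₀ Φ C₀ p₀) (hα : ∀ k, 0 ≤ α k)
    (hsum : ∀ (k : ℕ) (c : Fin (k + 1) → E), good k c → ∀ ρ : Fin k → ℝ, (∀ i, 0 < ρ i) →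
      ‖S₀ k c (fun i => (ρ i : ℂ))‖ ≤ α k * ((1 + ∑ i, ρ i) * (1 + ∑ i, (ρ i)⁻¹)) ^ (t * k))
    (hγ : 1 ≤ γ)
    (hα2 : ∀ (k : ℕ) (p : Fin k), Real.sqrt (α (p + 1 + p) * α (k - 1 - p + 1 + (k - 1 - p))) ≤ γ ^ k * α k) :
    ∃ Sext : (k : ℕ) → (Fin (k + 1) → E) → (Fin k → ℂ) → ℂ,
      (∀ (k : ℕ) (c : Fin (k + 1) → E), good k c → 0 < k → DifferentiableOn ℂ (Sext k c) {Z | ∀ i, 0 < (Z i).re}) ∧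
      (∀ (k : ℕ) (c : Fin (k + 1) → E), good k c → ∀ ρ : Fin k → ℝ, (∀ i, 0 < ρ i) →
        Sext k c (fun i => (ρ i : ℂ)) = S₀ k c (fun i => (ρ i : ℂ))) ∧
      ∀ k : ℕ, 0 < k → ∀ c : Fin (k + 1) → E, good k c → ∀ ζ : Fin k → ℂ, (∀ i, 0 < (ζ i).re) →
        ‖Sext k c ζ‖ ≤ α k * temperedQ CT γ t k * (1 + ∑ i, ‖ζ i‖) ^ temperedE CT γ t k *
          (1 + ∑ i, ((ζ i).re)⁻¹) ^ temperedE CT γ t k := by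
  classical
  -- the tower started at the first level
  obtain ⟨S, hL0, hG0, hrealS⟩ := hD.exists_levelZero hT hΦ hgood
  obtain ⟨Sx, hholx, heqx, -, hSchwx⟩ := hL0.exists_tower hT hΦ hgood hG0
  set Sfam : (k : ℕ) → (Fin (k + 1) → E) → (Fin k → ℂ) → ℂ := fun k c Z =>
    if 0 < k then Sx k c Z else S₀ k c Z with hSfam
  have hSf : ∀ k, 0 < k → ∀ c, Sfam k c = Sx k c := fun k hk c => by funext Z; simp only [hSfam, if_pos hk]
  have hhol : ∀ (k : ℕ) (c : Fin (k + 1) → E), good k c → 0 < k →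
      DifferentiableOn ℂ (Sfam k c) {Z | ∀ i, 0 < (Z i).re} := fun k c hc hk => by
    rw [hSf k hk]; exact hholx k c hc hk
  have hreal : ∀ (k : ℕ) (c : Fin (k + 1) → E), good k c → ∀ ρ : Fin k → ℝ, (∀ i, 0 < ρ i) →
      Sfam k c (fun i => (ρ i : ℂ)) = S₀ k c (fun i => (ρ i : ℂ)) := by
    intro k c hc ρ hρ
    rcases Nat.eq_zero_or_pos k with rfl | hk
    · simp only [hSfam, lt_self_iff_false, if_false]
    · rw [hSf k hk]
      have hmem : (fun i => (ρ i : ℂ)) ∈ argRegion (osBaseC (0 + 1) k) :=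
        ofReal_mem_argRegion (zero_mem_osBaseC _ hk) hρ
      rw [heqx k c hmem, hrealS k c ρ hρ]
  have hSchw : ∀ (k : ℕ) (c : Fin (k + 1) → E), good k c → ∀ (p : Fin k) (Z : Fin k → ℂ), (∀ i, 0 < (Z i).re) →
      ∀ (x' x : ℝ) (τ : ℂ), 0 < x' → 0 < x → 0 < τ.re → (x' : ℂ) + x + τ = Z p →
        ‖Sfam k c Z‖ ≤ CT *
          Real.sqrt ((Sfam (p + 1 + p) (dblPos (posRevLeft c p))
            (cDiagEmbed (blockRevLeft Z p) ((2 * x' : ℝ) : ℂ) (star (blockRevLeft Z p)))).re) *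
          Real.sqrt ((Sfam (k - 1 - p + 1 + (k - 1 - p)) (dblPos (posRight c p))
            (cDiagEmbed (star (blockRight Z p)) ((2 * x : ℝ) : ℂ) (blockRight Z p))).re) := by
    intro k c hc p Z hZ x' x τ hx' hx hτ hsplit
    rw [hSf k (Fin.pos p), hSf (p + 1 + p) (by omega), hSf (k - 1 - p + 1 + (k - 1 - p)) (by omega)]
    exact (hSchwx k c hc p Z hZ x' x τ hx' hx hτ.le hsplit).trans (mul_le_mul_of_nonneg_right
      (mul_le_mul_of_nonneg_right (hT.norm_le τ hτ) (Real.sqrt_nonneg _)) (Real.sqrt_nonneg _))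
  refine ⟨Sfam, hhol, hreal, fun k hk => ?_⟩
  -- the data-independent level constant and the dyadic bound on `g`
  obtain ⟨k', rfl⟩ : ∃ k', k = k' + 1 := ⟨k - 1, by omega⟩
  obtain ⟨hA1, hA⟩ := levA_spec k'
  set A : ℝ := levA k' with hAdef
  set g : ℝ := gConst CT γ t with hg
  have hg1 : 1 ≤ g := one_le_gConst CT hγ t
  set dg : ℕ := dgOf CT γ t with hdgdef
  have hdg : g < 2 ^ dg := dgOf_spec CT γ t
  -- the constants
  set kk : ℕ := k' + 1 with hkk
  set Cfin : ℝ := lev0A CT α kk * (10 * kk : ℝ) ^ (t * kk) * (6 * kk : ℝ) ^ (t * kk) *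
    (4 * A) ^ (dg * kk) * (2 * (kk + 1) : ℝ) ^ (kk * t) with hCfin
  have hkpos : 0 < kk := Nat.succ_pos k'
  -- the explicit constant dominates `Cfin`
  have hQ : Cfin ≤ α kk * temperedQ CT γ t kk := by
    have hle := lev0A_le (CT := CT) hα hγ hα2 hkpos
    have hP : 0 ≤ (10 * kk : ℝ) ^ (t * kk) * (6 * kk : ℝ) ^ (t * kk) * (4 * A) ^ (dg * kk) * (2 * (kk + 1) : ℝ) ^ (kk * t) := by
      have : 0 ≤ A := zero_le_one.trans hA1
      positivity
    have heq : α kk * temperedQ CT γ t kk = (max 1 CT * kk * γ ^ kk * α kk) *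
        ((10 * kk : ℝ) ^ (t * kk) * (6 * kk : ℝ) ^ (t * kk) * (4 * A) ^ (dg * kk) * (2 * (kk + 1) : ℝ) ^ (kk * t)) := by
      simp only [temperedQ, hAdef, hdgdef, hkk, Nat.add_sub_cancel]; push_cast; ring
    rw [heq, hCfin, mul_assoc, mul_assoc, mul_assoc]
    rw [show (10 * (kk : ℝ)) ^ (t * kk) * ((6 * (kk : ℝ)) ^ (t * kk) * ((4 * A) ^ (dg * kk) * (2 * ((kk : ℝ) + 1)) ^ (kk * t))) =
      (10 * kk : ℝ) ^ (t * kk) * (6 * kk : ℝ) ^ (t * kk) * (4 * A) ^ (dg * kk) * (2 * (kk + 1) : ℝ) ^ (kk * t) by ring]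
    exact mul_le_mul_of_nonneg_right hle hP
  intro c hc ζ hζ
  suffices hmain : ‖Sfam kk c ζ‖ ≤ Cfin * (1 + ∑ i, ‖ζ i‖) ^ (2 * dg * kk + 2 * kk * t) *
      (1 + ∑ i, ((ζ i).re)⁻¹) ^ (2 * dg * kk + 2 * kk * t) by
    have he : temperedE CT γ t kk = 2 * dg * kk + 2 * kk * t := by simp only [temperedE, hdgdef]
    rw [he]
    refine hmain.trans (mul_le_mul_of_nonneg_right (mul_le_mul_of_nonneg_right hQ (by positivity)) ?_)
    have : 0 ≤ ∑ i, ((ζ i).re)⁻¹ := Finset.sum_nonneg fun i _ => (inv_pos.2 (hζ i)).le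
    positivity
  have hk1 : (1 : ℝ) ≤ kk := by exact_mod_cast hkpos
  -- the shift
  set ρ : ℝ := ∑ i, ((ζ i).re)⁻¹ with hρ
  have hρpos : 0 < ρ := by
    rw [hρ]; exact Finset.sum_pos (fun i _ => inv_pos.2 (hζ i)) ⟨0, Finset.mem_univ _⟩
  have hρi : ∀ i, ((ζ i).re)⁻¹ ≤ ρ := fun i =>
    Finset.single_le_sum (f := fun i => ((ζ i).re)⁻¹) (fun i _ => (inv_pos.2 (hζ i)).le) (Finset.mem_univ i)
  set ε : ℝ := min 1 (1 / (2 * ρ)) with hε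
  have hε0 : 0 < ε := lt_min one_pos (by positivity)
  have hε1 : ε ≤ 1 := min_le_left _ _
  have hεre : ∀ i, ε ≤ (ζ i).re / 2 := fun i => by
    have h1 : ε ≤ 1 / (2 * ρ) := min_le_right _ _
    have h2 : 1 / (2 * ρ) ≤ (ζ i).re / 2 := by
      rw [div_le_div_iff₀ (by positivity) two_pos]
      have h3 : ((ζ i).re)⁻¹ * (ζ i).re = 1 := inv_mul_cancel₀ (hζ i).ne'
      nlinarith [hρi i, hζ i]
    linarith
  have hεinv : ε⁻¹ ≤ 1 + 2 * ρ := by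
    rw [hε]
    rcases le_total 1 (1 / (2 * ρ)) with h | h
    · rw [min_eq_left h, inv_one]; linarith
    · rw [min_eq_right h, one_div, inv_inv]; linarith
  set Z : Fin kk → ℂ := fun i => ζ i - ε with hZ
  have hZre : ∀ i, 0 < (Z i).re := fun i => by
    simp only [hZ, Complex.sub_re, Complex.ofReal_re]; linarith [hεre i, hζ i]
  have hZre' : ∀ i, (ζ i).re / 2 ≤ (Z i).re := fun i => by
    simp only [hZ, Complex.sub_re, Complex.ofReal_re]; linarith [hεre i]
  have hshift : shiftVec ε Z = ζ := by funext i; simp [hZ, shiftVec]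
  -- the level
  obtain ⟨N, hN, h2N⟩ := hA Z hZre
  have hZmem : Z ∈ argRegion (osBaseC (N + 1) kk) := ⟨hZre, hN⟩
  -- (6.28) at level `N`
  have hreg := hD.norm_regFun_le_level hT hΦ hgood hα hsum hγ hα2 hε0 hε1 hhol hreal hSchw N kk c hc Z hZmem
  -- undo the weight
  have hw0 : osWeight kk ε t Z ≠ 0 := osWeight_ne_zero hkpos hε0 t hZre
  have hval : ‖Sfam kk c ζ‖ = ‖regFun Sfam ε t kk c Z‖ * ‖osW kk ε Z‖ ^ (kk * t) := by
    rw [regFun, hshift, norm_mul, osWeight, norm_pow, norm_inv, mul_comm, ← mul_assoc, ← mul_pow,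
      mul_inv_cancel₀ (norm_ne_zero_iff.2 (osW_ne_zero hkpos hε0 hZre)), one_pow, one_mul]
  -- the quantities in terms of `Sζ = ∑‖ζᵢ‖` and `ρ`
  set Sζ : ℝ := ∑ i, ‖ζ i‖ with hSζ
  have hSζ0 : 0 ≤ Sζ := Finset.sum_nonneg fun i _ => norm_nonneg _
  have hZnorm : ∀ i, ‖Z i‖ ≤ ‖ζ i‖ + 1 := fun i => by
    calc ‖Z i‖ = ‖ζ i - ε‖ := rfl
      _ ≤ ‖ζ i‖ + ‖(ε : ℂ)‖ := norm_sub_le _ _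
      _ ≤ ‖ζ i‖ + 1 := by rw [Complex.norm_real, Real.norm_eq_abs, abs_of_pos hε0]; linarith
  have hsumZ : ∑ i, ‖Z i‖ ≤ Sζ + kk := by
    calc ∑ i, ‖Z i‖ ≤ ∑ i, (‖ζ i‖ + 1) := Finset.sum_le_sum fun i _ => hZnorm i
      _ = Sζ + kk := by rw [Finset.sum_add_distrib, Finset.sum_const, Finset.card_univ, Fintype.card_fin]; simp [hSζ]
  -- (a) the weight base
  have hosW : ‖osW kk ε Z‖ ≤ 2 * (kk + 1) * ((1 + Sζ) * (1 + ρ)) := by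
    have h1 : ‖osW kk ε Z‖ ≤ ε⁻¹ + (∑ i, ‖Z i‖) / kk := by
      unfold osW
      refine (norm_add_le _ _).trans (add_le_add (by rw [Complex.norm_real, Real.norm_eq_abs, abs_of_pos (inv_pos.2 hε0)]) ?_)
      rw [norm_div, show ((kk : ℂ)) = ((kk : ℝ) : ℂ) by simp, Complex.norm_real, Real.norm_eq_abs,
        abs_of_pos (by positivity)]
      exact div_le_div_of_nonneg_right (norm_sum_le _ _) (by positivity)
    have h2 : (∑ i, ‖Z i‖) / kk ≤ Sζ + kk := by
      rw [div_le_iff₀ (by positivity)]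
      have : 0 ≤ ∑ i, ‖Z i‖ := Finset.sum_nonneg fun i _ => norm_nonneg _
      nlinarith [hsumZ]
    have h3 : ε⁻¹ + (Sζ + kk) ≤ 2 * (kk + 1) * ((1 + Sζ) * (1 + ρ)) := by
      have p1 : 0 ≤ (kk : ℝ) * Sζ := mul_nonneg (Nat.cast_nonneg _) hSζ0
      have p2 : 0 ≤ (kk : ℝ) * ρ := mul_nonneg (Nat.cast_nonneg _) hρpos.le
      have p3 : 0 ≤ Sζ * ρ := mul_nonneg hSζ0 hρpos.le
      have p4 : 0 ≤ (kk : ℝ) * Sζ * ρ := mul_nonneg p1 hρpos.le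
      have hexp : 2 * ((kk : ℝ) + 1) * ((1 + Sζ) * (1 + ρ)) =
          2 * kk + 2 + 2 * (kk * Sζ) + 2 * Sζ + 2 * (kk * ρ) + 2 * ρ + 2 * (kk * Sζ * ρ) + 2 * (Sζ * ρ) := by ring
      rw [hexp]
      linarith [hεinv, hρpos.le, hSζ0, hk1]
    linarith
  -- (b) the level factor
  have hTsum : ∑ i, ‖Z i‖ / (Z i).re ≤ 2 * (1 + Sζ) * (1 + ρ) := by
    calc ∑ i, ‖Z i‖ / (Z i).re ≤ ∑ i, (1 + Sζ) * (2 * ((ζ i).re)⁻¹) := Finset.sum_le_sum fun i _ => by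
          rw [div_le_iff₀ (hZre i)]
          have hn : ‖Z i‖ ≤ 1 + Sζ := (hZnorm i).trans (by
            have := Finset.single_le_sum (f := fun i => ‖ζ i‖) (fun i _ => norm_nonneg _) (Finset.mem_univ i)
            linarith)
          have h4 : (1 + Sζ) * (2 * ((ζ i).re)⁻¹) * (Z i).re ≥ (1 + Sζ) * (2 * ((ζ i).re)⁻¹) * ((ζ i).re / 2) :=
            mul_le_mul_of_nonneg_left (hZre' i) (mul_nonneg (by linarith) (mul_nonneg zero_le_two (inv_pos.2 (hζ i)).le))
          have h5 : (1 + Sζ) * (2 * ((ζ i).re)⁻¹) * ((ζ i).re / 2) = 1 + Sζ := by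
            rw [show (1 + Sζ) * (2 * ((ζ i).re)⁻¹) * ((ζ i).re / 2) = (1 + Sζ) * (((ζ i).re)⁻¹ * (ζ i).re) by ring,
              inv_mul_cancel₀ (hζ i).ne', mul_one]
          linarith
      _ = 2 * (1 + Sζ) * ρ := by rw [← Finset.mul_sum, ← Finset.mul_sum, hρ]; ring
      _ ≤ 2 * (1 + Sζ) * (1 + ρ) := by nlinarith
  have hlev : g ^ (kk * N) ≤ (4 * A * ((1 + Sζ) * (1 + ρ)) ^ 2) ^ (dg * kk) := by
    have h1 : g ^ (kk * N) ≤ ((2 : ℝ) ^ dg) ^ (kk * N) := pow_le_pow_left₀ (zero_le_one.trans hg1) hdg.le _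
    have h2 : ((2 : ℝ) ^ dg) ^ (kk * N) = ((2 : ℝ) ^ N) ^ (dg * kk) := by
      rw [← pow_mul, ← pow_mul]; ring_nf
    have h3 : (2 : ℝ) ^ N ≤ 4 * A * ((1 + Sζ) * (1 + ρ)) ^ 2 := by
      refine h2N.trans ?_
      calc A * (∑ i, ‖Z i‖ / (Z i).re) ^ 2 ≤ A * (2 * (1 + Sζ) * (1 + ρ)) ^ 2 := by
            refine mul_le_mul_of_nonneg_left (pow_le_pow_left₀ ?_ hTsum 2) (zero_le_one.trans hA1)
            exact Finset.sum_nonneg fun i _ => div_nonneg (norm_nonneg _) (hZre i).le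
        _ = 4 * A * ((1 + Sζ) * (1 + ρ)) ^ 2 := by ring
    rw [h2] at h1
    exact h1.trans (pow_le_pow_left₀ (by positivity) h3 _)
  -- (c) the first-level constant at this `ε`
  have hlev0 : lev0Const CT α t kk ε ≤ lev0A CT α kk * (10 * kk : ℝ) ^ (t * kk) * (6 * kk : ℝ) ^ (t * kk) * (1 + ρ) ^ (t * kk) := by
    unfold lev0Const
    have h1 : 1 + 4 * (kk : ℝ) / ε ≤ 10 * kk * (1 + ρ) := by
      rw [div_eq_mul_inv]
      have e1 : 4 * (kk : ℝ) * ε⁻¹ ≤ 4 * kk * (1 + 2 * ρ) := mul_le_mul_of_nonneg_left hεinv (by positivity)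
      have e2 : 0 ≤ (kk : ℝ) * ρ := mul_nonneg (Nat.cast_nonneg _) hρpos.le
      have hexp1 : 4 * (kk : ℝ) * (1 + 2 * ρ) = 4 * kk + 8 * (kk * ρ) := by ring
      have hexp2 : 10 * (kk : ℝ) * (1 + ρ) = 10 * kk + 10 * (kk * ρ) := by ring
      rw [hexp2]; rw [hexp1] at e1
      linarith [hk1]
    calc lev0A CT α kk * (1 + 4 * (kk : ℝ) / ε) ^ (t * kk) * (6 * kk : ℝ) ^ (t * kk)
        ≤ lev0A CT α kk * (10 * kk * (1 + ρ)) ^ (t * kk) * (6 * kk : ℝ) ^ (t * kk) := by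
          have := lev0A_nonneg (CT := CT) hα kk
          gcongr
      _ = lev0A CT α kk * (10 * kk : ℝ) ^ (t * kk) * (6 * kk : ℝ) ^ (t * kk) * (1 + ρ) ^ (t * kk) := by
          rw [mul_pow]; ring
  -- assemble
  set X : ℝ := (1 + Sζ) * (1 + ρ) with hX
  have hX1 : 1 ≤ X := by rw [hX]; nlinarith
  have hX0 : 0 ≤ X := zero_le_one.trans hX1
  have hA0 : 0 ≤ lev0A CT α kk := lev0A_nonneg hα kk
  have hApos : 0 ≤ A := zero_le_one.trans hA1
  set C1 : ℝ := lev0A CT α kk * (10 * kk : ℝ) ^ (t * kk) * (6 * kk : ℝ) ^ (t * kk) with hC1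
  have hC10 : 0 ≤ C1 := by rw [hC1]; positivity
  -- the regularised function
  have hR1 : ‖regFun Sfam ε t kk c Z‖ ≤ C1 * (1 + ρ) ^ (t * kk) * ((4 * A) ^ (dg * kk) * X ^ (2 * (dg * kk))) := by
    have h := hreg
    rw [levConst] at h
    refine h.trans ?_
    have e1 : (4 * A * X ^ 2) ^ (dg * kk) = (4 * A) ^ (dg * kk) * X ^ (2 * (dg * kk)) := by
      rw [mul_pow, ← pow_mul]
    rw [← e1]
    exact mul_le_mul hlev0 hlev (pow_nonneg (zero_le_one.trans hg1) _) (by positivity)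
  -- the weight
  have hR2 : ‖osW kk ε Z‖ ^ (kk * t) ≤ (2 * (kk + 1) : ℝ) ^ (kk * t) * X ^ (kk * t) := by
    rw [← mul_pow]; exact pow_le_pow_left₀ (norm_nonneg _) hosW _
  -- the product
  have hXpow : ∀ a : ℕ, X ^ a = (1 + Sζ) ^ a * (1 + ρ) ^ a := fun a => by rw [hX, mul_pow]
  have he1 : 2 * (dg * kk) + kk * t ≤ 2 * dg * kk + 2 * kk * t := by nlinarith
  have he2 : t * kk + (2 * (dg * kk) + kk * t) ≤ 2 * dg * kk + 2 * kk * t := by nlinarith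
  rw [hval]
  calc ‖regFun Sfam ε t kk c Z‖ * ‖osW kk ε Z‖ ^ (kk * t)
      ≤ (C1 * (1 + ρ) ^ (t * kk) * ((4 * A) ^ (dg * kk) * X ^ (2 * (dg * kk)))) *
          ((2 * (kk + 1) : ℝ) ^ (kk * t) * X ^ (kk * t)) :=
        mul_le_mul hR1 hR2 (by positivity) (by positivity)
    _ = Cfin * ((1 + ρ) ^ (t * kk) * X ^ (2 * (dg * kk) + kk * t)) := by
        rw [hCfin, hC1, pow_add]; ring
    _ = Cfin * ((1 + Sζ) ^ (2 * (dg * kk) + kk * t) * (1 + ρ) ^ (t * kk + (2 * (dg * kk) + kk * t))) := by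
        rw [hXpow, pow_add (1 + ρ) (t * kk)]; ring
    _ ≤ Cfin * ((1 + Sζ) ^ (2 * dg * kk + 2 * kk * t) * (1 + ρ) ^ (2 * dg * kk + 2 * kk * t)) := by
        refine mul_le_mul_of_nonneg_left (mul_le_mul (pow_le_pow_right₀ (by linarith) he1) (pow_le_pow_right₀ (by linarith) he2)
          (by positivity) (by positivity)) ?_
        rw [hCfin]; positivity
    _ = Cfin * (1 + Sζ) ^ (2 * dg * kk + 2 * kk * t) * (1 + ρ) ^ (2 * dg * kk + 2 * kk * t) := by ring

end Undo

end Literature.MathematicalPhysics.QuantumFieldTheory.OSEnvelope
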